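import Summits.Schanuel.Schanuel.Theorems.ZilberEacMovingLineDefs
import Summits.Schanuel.Schanuel.Theorems.ZilberEacGrowthExponent
import Summits.Schanuel.Schanuel.Theorems.ZilberEacComplexRealHyperplaneSlow
import Summits.Schanuel.Schanuel.Theorems.ZilberEacComplexOscillatoryBase
import Summits.Schanuel.Schanuel.Theorems.ZilberEacGrowthDensityPuncture
import HarnessLib

/-!
# The moving-target line family: Zariski density of the exponential points

Zilber's Exponential-Algebraic Closedness, case ladder (host summit Schanuel, cell `pub-schanuel`,
seat 2, gen 8).  The first NON-SPLIT family for Mantova–Masser's density question (PLMS 2024, §1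
"Further remarks"): the surfaces
`W(a, b; A, F) = {x₁ = a x₀ + b, y₀ = A(x₀) + y₁ F(y₁)} ⊆ ℂ² × ℂ²`
(`movingLineSurface a b A F` of `ZilberEacMovingLineDefs`; base the line `x₁ = a x₀ + b`, fibre
`y₀ = A(x₀) + y₁ F(y₁)` MOVING with `x₀` — not of product form `L × C`), whose exponential points are
the solutions of `e^{z} = A(z) + e^{a z + b} F(e^{a z + b})`.

* `unprojectedDense_movingLine_real`: `a ∈ ℝ ∖ ℚ`, `deg A ≥ 1`, slow growth
  `a deg A + max(a deg A, 0) deg F < deg A` (all `a < 0`; `0 < a < 1/(1 + deg F)`): the exponential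
  points are ZARISKI DENSE in `W`.  Existence near the lattice centres `2πi m + log A(2πi m)` is
  THEOREM R⁺ (`exists_expPoint_realHyperplane_slow`); density is THEOREM I
  (`unprojectedDense_of_logGrowth_irrational`): there `log |y₀| = d log m + O(1)` and
  `log |y₁| = a d log m + O(1)` with `d = deg A ≠ 0`, `a ∉ ℚ`.
* `unprojectedDense_movingLine_of_im_ne_zero`: `a ∉ ℝ`, `A ≠ 0`, any `F`: dense (existence by the
  negative-leading-form theorem `exists_expPoint_of_re_leadingForm_neg` along the lattice ray
  `q = sign(Im a)`, density by THEOREM G: `|Re x₁| ≍ m` against `log ‖x₁‖ ≍ log m`).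

HONEST FRAMING: explicit families of instances of an OPEN question; existence for these systems was
already in the tree (THEOREMS R, R⁺, oscillatory base); NEW is the Zariski density for a
non-split family; `EC(3,2)` OPEN; NOT Schanuel's conjecture; EAC ⇏ SC.
-/

noncomputable section

open Complex MvPolynomial Filter Topology
open Literature.NumberTheory.Transcendental Literature.ModelTheory.Zilber

set_option linter.dupNamespace false

namespace Summit.Schanuel.Schanuel.Theorems

/-! ## Part 3. Real irrational slope: density by THEOREM I -/

section RealSlope

/-- **The real-slope engine.**  For `a ∈ ℝ ∖ ℚ`, `deg A ≥ 1`: if for all large `m` the equation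
`e^{x} = A(x) + e^{ax+b} F(e^{ax+b})` has a solution within `1/2` of the lattice centre
`2πi m + log A(2πi m)`, then the exponential points of `W(a, b; A, F)` are Zariski dense.  Along
such solutions `log |y₀| = Re x = d log m + O(1)` and `log |y₁| = a Re x + Re b = a d log m + O(1)`
(`latticeCentre_control`), and THEOREM I (`unprojectedDense_of_logGrowth_irrational`) applies to
the coordinates `(y₀, y₁)`. (new) -/
theorem unprojectedDense_movingLine_real_of_eventually {a : ℝ} (ha : Irrational a) (b : ℂ)
    {A : Polynomial ℂ} (hA : 0 < A.natDegree) (F : Polynomial ℂ)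
    (hsol : ∀ᶠ m : ℕ in atTop, ∃ x : ℂ,
      ‖x - ((m : ℂ) * (2 * Real.pi * I * ((1 : ℤ) : ℂ)) +
        log (A.eval ((m : ℂ) * (2 * Real.pi * I * ((1 : ℤ) : ℂ)))))‖ ≤ 1 / 2 ∧
      exp x = A.eval x + exp ((a : ℂ) * x + b) * F.eval (exp ((a : ℂ) * x + b))) :
    UnprojectedDense (movingLineSurface a b A F) := by
  classical
  have hA0 : A ≠ 0 := by rintro rfl; simp at hA
  obtain ⟨x, M, C, hmM, -, hM1, hsys, hctrl⟩ := exists_controlled_solutions hA0 one_ne_zero hsol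
  -- the sequence of exponential points
  set p : ℕ → Fin 2 ⊕ Fin 2 → ℂ := fun m => mlPoint a b (x m) with hp
  have hpS : ∀ m, p m ∈ movingLineSurface a b A F := fun m => (mlPoint_mem_iff _ _ _ _ _).2 (hsys m)
  have hpΓ : ∀ m, p m ∈ expGraph ℂ 2 := fun m => mlPoint_mem_expGraph _ _ _
  set T : ℕ → ℝ := fun m => Real.log (M m) with hT
  have hTlim : Tendsto T atTop atTop := by
    refine Real.tendsto_log_atTop.comp (tendsto_natCast_atTop_atTop.comp ?_)
    exact tendsto_atTop_mono hmM tendsto_id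
  have hd : (A.natDegree : ℝ) ≠ 0 := by exact_mod_cast hA.ne'
  refine unprojectedDense_of_logGrowth_irrational (isIrreducibleClosed_movingLineSurface _ _ _ _)
    (zariskiDim_movingLineSurface _ _ _ _).le (Sum.inr 0) (Sum.inr 1) hpS hpΓ hTlim ha hd
    (E := C + |a| * C + |b.re|) (Eventually.of_forall fun m => ⟨exp_ne_zero _, ?_⟩)
    (Eventually.of_forall fun m => ⟨exp_ne_zero _, ?_⟩)
  · -- `log |y₀| = Re x`
    simp only [hp, mlPoint_inr_zero, Complex.norm_exp, Real.log_exp, hT]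
    have h := (hctrl m).1
    have : 0 ≤ |a| * C + |b.re| := by
      have hC : 0 ≤ C := (abs_nonneg _).trans h
      positivity
    linarith
  · -- `log |y₁| = a Re x + Re b`
    simp only [hp, mlPoint_inr_one, Complex.norm_exp, Real.log_exp, hT, Complex.add_re,
      Complex.re_ofReal_mul]
    have h := (hctrl m).1
    have hC : 0 ≤ C := (abs_nonneg _).trans h
    have e : a * (x m).re + b.re - a * A.natDegree * Real.log (M m) =
        a * ((x m).re - A.natDegree * Real.log (M m)) + b.re := by ring
    rw [e]
    calc |a * ((x m).re - A.natDegree * Real.log (M m)) + b.re|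
        ≤ |a * ((x m).re - A.natDegree * Real.log (M m))| + |b.re| := abs_add_le _ _
      _ = |a| * |(x m).re - A.natDegree * Real.log (M m)| + |b.re| := by rw [abs_mul]
      _ ≤ |a| * C + |b.re| := by gcongr
      _ ≤ C + |a| * C + |b.re| := by linarith

/-- **THEOREM R⁺ in one variable, scalar form**: for real `r`, `deg A ≥ 1` and
`r deg A + max(r deg A, 0) deg F < deg A`, the equation `e^{x} = A(x) + e^{r x + b} F(e^{r x + b})`
has, for all large `m`, a solution within `1/2` of `2πi m + log A(2πi m)`. (new) -/
theorem eventually_exists_solution_realLine (r : ℝ) (b : ℂ) {A : Polynomial ℂ} (hA : A ≠ 0)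
    (F : Polynomial ℂ)
    (hslow : r * A.natDegree + max (r * A.natDegree) 0 * F.natDegree < A.natDegree) :
    ∀ᶠ m : ℕ in atTop, ∃ x : ℂ,
      ‖x - ((m : ℂ) * (2 * Real.pi * I * ((1 : ℤ) : ℂ)) +
        log (A.eval ((m : ℂ) * (2 * Real.pi * I * ((1 : ℤ) : ℂ)))))‖ ≤ 1 / 2 ∧
      exp x = A.eval x + exp ((r : ℂ) * x + b) * F.eval (exp ((r : ℂ) * x + b)) := by
  classical
  set q : Fin 1 → ℤ := fun _ => 1 with hq
  set rv : Fin 1 → ℝ := fun _ => r with hr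
  set A' : Fin 1 → MvPolynomial (Fin 1) ℂ := fun _ => A.toMvPolynomial 0 with hA'def
  set F' : Fin 1 → Polynomial ℂ := fun _ => F with hF'
  have hpi : (2 * Real.pi * I * ((1 : ℤ) : ℂ)) ≠ 0 := by
    have := Real.pi_pos
    simp [Complex.ext_iff, this.ne']
  have hA' : ∀ j, eval (fun i => 2 * Real.pi * I * (q i : ℂ))
      (homogeneousComponent (A' j).totalDegree (A' j)) ≠ 0 := fun _ =>
    eval_leadingForm_toMvPolynomial_fin_one_ne_zero hA hpi
  have hlam : ∀ j, (∑ i, rv i * (A' i).totalDegree) +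
      max (∑ i, rv i * (A' i).totalDegree) 0 * ((F' j).natDegree : ℝ) < (A' j).totalDegree := by
    intro j
    simp only [Fin.sum_univ_one, hr, hA'def, hF', totalDegree_toMvPolynomial_fin_one]
    exact hslow
  filter_upwards [exists_expPoint_realHyperplane_slow rv b q A' hA' F' hlam] with m ⟨x, hx, hsys⟩
  refine ⟨x 0, ?_, ?_⟩
  · refine (norm_le_pi_norm (x - _) 0).trans_eq' ?_ |>.trans hx
    simp only [Pi.sub_apply, hA'def, hq, MvPolynomial.eval_toMvPolynomial]
  · have h := hsys 0
    simp only [hA'def, hF', hr, MvPolynomial.eval_toMvPolynomial, Fin.sum_univ_one] at h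
    exact h

/-- **Density for the moving-target family over a line of real irrational slope (slow growth).**
Let `a ∈ ℝ ∖ ℚ`, `b ∈ ℂ`, `A ∈ ℂ[x]` of degree `d ≥ 1`, `F ∈ ℂ[u]`, and assume
`a d + max(a d, 0) · deg F < d` (e.g. every `a < 0`; `0 < a < 1/(1 + deg F)`).  Then the
exponential points of `W(a, b; A, F) = {x₁ = a x₀ + b, y₀ = A(x₀) + y₁ F(y₁)}` — the solutions of
`e^{z} = A(z) + e^{a z + b} F(e^{a z + b})` — are ZARISKI DENSE in `W` (`UnprojectedDense`).
Proof: THEOREM R⁺ gives solutions near the lattice centres `2πi m + log A(2πi m)`, where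
`log |y₀| = Re z = d log m + O(1)` and `log |y₁| = a Re z + Re b = a d log m + O(1)`; THEOREM I.
(new) [cite: MantovaMasser2023, §1 Further remarks] -/
theorem unprojectedDense_movingLine_real {a : ℝ} (ha : Irrational a) (b : ℂ) {A : Polynomial ℂ}
    (hA : 0 < A.natDegree) (F : Polynomial ℂ)
    (hslow : a * A.natDegree + max (a * A.natDegree) 0 * F.natDegree < A.natDegree) :
    UnprojectedDense (movingLineSurface a b A F) :=
  have hA0 : A ≠ 0 := by rintro rfl; simp at hA
  unprojectedDense_movingLine_real_of_eventually ha b hA F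
    (eventually_exists_solution_realLine a b hA0 F hslow)

/-- **The pure moving target `e^{z} = A(z)`, every irrational real slope.**  For `a ∈ ℝ ∖ ℚ`,
`b ∈ ℂ` and `deg A ≥ 1` the exponential points `(z, a z + b, A(z), e^{a z + b})`, `e^{z} = A(z)`, of
`W(a, b; A, 0) = {x₁ = a x₀ + b, y₀ = A(x₀)}` are ZARISKI DENSE — no growth condition: the equation
does not involve `a`, so THEOREM R⁺ is used with slope `0`. (new)
[cite: MantovaMasser2023, §1 Further remarks] -/
theorem unprojectedDense_movingLine_real_zero {a : ℝ} (ha : Irrational a) (b : ℂ)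
    {A : Polynomial ℂ} (hA : 0 < A.natDegree) : UnprojectedDense (movingLineSurface a b A 0) := by
  have hA0 : A ≠ 0 := by rintro rfl; simp at hA
  refine unprojectedDense_movingLine_real_of_eventually ha b hA 0 ?_
  have h0 : (0 : ℝ) * A.natDegree + max ((0 : ℝ) * A.natDegree) 0 * (0 : Polynomial ℂ).natDegree <
      A.natDegree := by
    simp only [zero_mul, max_self, Polynomial.natDegree_zero, Nat.cast_zero, mul_zero, add_zero]
    exact_mod_cast hA
  filter_upwards [eventually_exists_solution_realLine 0 b hA0 0 h0] with m ⟨x, hx, hsys⟩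
  refine ⟨x, hx, ?_⟩
  rw [Polynomial.eval_zero, mul_zero] at hsys ⊢
  exact hsys

end RealSlope

/-! ## Part 4. Non-real slope: density by THEOREM G -/

section NonRealSlope

/-- **Density for the moving-target family over a line of non-real slope.**  Let `a ∈ ℂ ∖ ℝ`,
`b ∈ ℂ`, `A ∈ ℂ[x] ∖ {0}`, `F ∈ ℂ[u]`.  Then the solutions of `e^{z} = A(z) + e^{a z + b} F(e^{a z + b})`
give ZARISKI DENSE exponential points of `W(a, b; A, F)`.  Existence near the lattice centres
`2πi q m + log A(2πi q m)`, `q = sign(Im a)`, is the negative-leading-form theorem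
(`exists_expPoint_of_re_leadingForm_neg`: `Re(a · 2πi q) = -2π q Im a < 0`); there
`Re x₁ = -2π q Im(a) m + O(log m)` while `‖x₁‖ = O(m)`, so THEOREM G (`unprojectedDense_of_growth`)
applies to the coordinate `x₁`. (new) [cite: MantovaMasser2023, §1 Further remarks] -/
theorem unprojectedDense_movingLine_of_im_ne_zero {a : ℂ} (ha : a.im ≠ 0) (b : ℂ)
    {A : Polynomial ℂ} (hA : A ≠ 0) (F : Polynomial ℂ) :
    UnprojectedDense (movingLineSurface a b A F) := by
  classical
  have ha0 : a ≠ 0 := fun h => ha (by rw [h, Complex.zero_im])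
  -- the lattice direction `q` with `q Im a > 0`
  obtain ⟨q, hqpos⟩ : ∃ q : ℤ, 0 < (q : ℝ) * a.im := by
    rcases lt_or_gt_of_ne ha with h | h
    · exact ⟨-1, by push_cast; nlinarith⟩
    · exact ⟨1, by push_cast; linarith⟩
  have hq0 : q ≠ 0 := by rintro rfl; simp at hqpos
  set qv : Fin 1 → ℤ := fun _ => q with hqv
  have hv0 : (2 * Real.pi * I * (q : ℂ)) ≠ 0 := by
    have hpi : (Real.pi : ℂ) ≠ 0 := Complex.ofReal_ne_zero.2 Real.pi_ne_zero
    exact mul_ne_zero (mul_ne_zero (mul_ne_zero two_ne_zero hpi) Complex.I_ne_zero)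
      (Int.cast_ne_zero.2 hq0)
  -- the base `a X₀ + b`: degree `1`, `Re (a · 2πi q) = -2π q Im a < 0`
  have hneg : (eval (fun j => 2 * Real.pi * I * (qv j : ℂ))
      (homogeneousComponent (linBase a b).totalDegree (linBase a b))).re < 0 := by
    rw [eval_leadingForm_linBase ha0]
    have : (a * (2 * Real.pi * I * (q : ℂ))).re = -(2 * Real.pi * (q * a.im)) := by
      simp [Complex.mul_re, Complex.mul_im]; ring
    simp only [hqv]
    rw [this]
    have := Real.pi_pos
    nlinarith
  set A' : Fin 1 → MvPolynomial (Fin 1) ℂ := fun _ => A.toMvPolynomial 0 with hA'def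
  set F' : Fin 1 → MvPolynomial (Fin (1 + 1)) ℂ := fun _ => F.toMvPolynomial 0 with hF'
  have hA' : ∀ j, eval (fun i => 2 * Real.pi * I * (qv i : ℂ))
      (homogeneousComponent (A' j).totalDegree (A' j)) ≠ 0 := fun _ =>
    eval_leadingForm_toMvPolynomial_fin_one_ne_zero hA hv0
  have hO := exists_expPoint_of_re_leadingForm_neg (linBase a b)
    (by rw [totalDegree_linBase ha0]; exact one_pos) qv hneg A' hA' F'
  -- scalar form of the solutions
  have hsol : ∀ᶠ m : ℕ in atTop, ∃ x : ℂ,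
      ‖x - ((m : ℂ) * (2 * Real.pi * I * (q : ℂ)) +
        log (A.eval ((m : ℂ) * (2 * Real.pi * I * (q : ℂ)))))‖ ≤ 1 / 2 ∧
      exp x = A.eval x + exp (a * x + b) * F.eval (exp (a * x + b)) := by
    filter_upwards [hO] with m ⟨x, hx, hsys⟩
    refine ⟨x 0, ?_, ?_⟩
    · refine (norm_le_pi_norm (x - _) 0).trans_eq' ?_ |>.trans hx
      simp only [Pi.sub_apply, hA'def, hqv, MvPolynomial.eval_toMvPolynomial]
    · have h := hsys 0
      simp only [hA'def, hF', MvPolynomial.eval_toMvPolynomial, Fin.cons_zero, eval_linBase] at h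
      exact h
  obtain ⟨x, M, C, hmM, hMm, hM1, hsys, hctrl⟩ := exists_controlled_solutions hA hq0 hsol
  -- the sequence of exponential points
  set p : ℕ → Fin 2 ⊕ Fin 2 → ℂ := fun m => mlPoint a b (x m) with hp
  have hpS : ∀ m, p m ∈ movingLineSurface a b A F := fun m => (mlPoint_mem_iff _ _ _ _ _).2 (hsys m)
  have hpΓ : ∀ m, p m ∈ expGraph ℂ 2 := fun m => mlPoint_mem_expGraph _ _ _
  refine unprojectedDense_of_growth (isIrreducibleClosed_movingLineSurface _ _ _ _)
    (zariskiDim_movingLineSurface _ _ _ _).le 1 hpS hpΓ ?_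
  simp only [hp, mlPoint_inl_one]
  -- constants
  have hC : 0 ≤ C := (abs_nonneg _).trans (hctrl 0).1
  set d : ℝ := (A.natDegree : ℝ) with hd
  have hd0 : 0 ≤ d := Nat.cast_nonneg _
  set c : ℝ := 2 * Real.pi * (q * a.im) with hc
  have hcpos : 0 < c := by have := Real.pi_pos; rw [hc]; positivity
  set C₁ : ℝ := |a.re| * C + |a.im| * C + |b.re| with hC₁
  set K : ℝ := ‖a‖ * (d + 2 * C + 2 * Real.pi * |(q : ℝ)|) + ‖b‖ with hK
  have hK0 : 0 ≤ K := by rw [hK]; positivity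
  -- pointwise estimates in terms of `M m`
  have hest : ∀ m, c * (M m) - |a.re| * d * Real.log (M m) - C₁ ≤ |(a * x m + b).re| ∧
      Real.log (2 + ‖a * x m + b‖) ≤ Real.log (2 + K) + Real.log (M m) := by
    intro m
    obtain ⟨h1, h2⟩ := hctrl m
    have hM := hM1 m
    have hlogM : 0 ≤ Real.log (M m) := Real.log_nonneg hM
    have hlogM' : Real.log (M m) ≤ M m := (Real.log_le_sub_one_of_pos (by linarith)).trans (by linarith)
    rw [abs_le] at h1 h2
    constructor
    · -- real part of `x₁ = a x + b`
      have hre : (a * x m + b).re = a.re * (x m).re - a.im * (x m).im + b.re := by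
        simp [Complex.mul_re]
      rw [hre]
      have e : a.re * (x m).re - a.im * (x m).im + b.re =
          -(c * M m) + (a.re * (x m).re - a.im * ((x m).im - 2 * Real.pi * q * (M m)) + b.re) := by
        rw [hc]; ring
      rw [e]
      have hbound : |a.re * (x m).re - a.im * ((x m).im - 2 * Real.pi * q * (M m)) + b.re| ≤
          |a.re| * (d * Real.log (M m) + C) + |a.im| * C + |b.re| := by
        have hxre : |(x m).re| ≤ d * Real.log (M m) + C := by
          rw [abs_le]; constructor <;> nlinarith
        have hxim : |(x m).im - 2 * Real.pi * q * (M m)| ≤ C := abs_le.2 ⟨h2.1, h2.2⟩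
        calc |a.re * (x m).re - a.im * ((x m).im - 2 * Real.pi * q * (M m)) + b.re|
            ≤ |a.re * (x m).re| + |a.im * ((x m).im - 2 * Real.pi * q * (M m))| + |b.re| := by
              have := abs_add_le (a.re * (x m).re - a.im * ((x m).im - 2 * Real.pi * q * (M m))) b.re
              have := abs_sub (a.re * (x m).re) (a.im * ((x m).im - 2 * Real.pi * q * (M m)))
              linarith
          _ = |a.re| * |(x m).re| + |a.im| * |(x m).im - 2 * Real.pi * q * (M m)| + |b.re| := by
              rw [abs_mul, abs_mul]
          _ ≤ |a.re| * (d * Real.log (M m) + C) + |a.im| * C + |b.re| := by gcongr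
      have htri : c * M m - |a.re * (x m).re - a.im * ((x m).im - 2 * Real.pi * q * (M m)) + b.re| ≤
          |-(c * M m) + (a.re * (x m).re - a.im * ((x m).im - 2 * Real.pi * q * (M m)) + b.re)| := by
        have := abs_add_le (-(c * M m) + (a.re * (x m).re - a.im * ((x m).im - 2 * Real.pi * q * (M m)) + b.re))
          (-(a.re * (x m).re - a.im * ((x m).im - 2 * Real.pi * q * (M m)) + b.re))
        rw [add_neg_cancel_right, abs_neg, abs_neg] at this
        have hcM : |c * M m| = c * M m := abs_of_nonneg (by positivity)
        linarith
      rw [hC₁]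
      nlinarith
    · -- the norm of `x₁`
      have hxnorm : ‖x m‖ ≤ (d * Real.log (M m) + C) + (2 * Real.pi * |(q : ℝ)| * M m + C) := by
        refine (Complex.norm_le_abs_re_add_abs_im _).trans (add_le_add ?_ ?_)
        · rw [abs_le]; constructor <;> nlinarith
        · have : |(x m).im| ≤ |(x m).im - 2 * Real.pi * q * (M m)| + |2 * Real.pi * q * (M m)| := by
            have := abs_add_le ((x m).im - 2 * Real.pi * q * (M m)) (2 * Real.pi * q * (M m))
            rwa [sub_add_cancel] at this
          have h3 : |2 * Real.pi * q * (M m)| = 2 * Real.pi * |(q : ℝ)| * M m := by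
            rw [abs_mul, abs_mul, abs_mul, abs_of_pos Real.pi_pos, abs_of_pos two_pos,
              abs_of_nonneg (by linarith : (0 : ℝ) ≤ M m)]
          have hxim : |(x m).im - 2 * Real.pi * q * (M m)| ≤ C := abs_le.2 ⟨h2.1, h2.2⟩
          linarith
      have hx1 : ‖a * x m + b‖ ≤ K * M m := by
        calc ‖a * x m + b‖ ≤ ‖a‖ * ‖x m‖ + ‖b‖ := by
              refine (norm_add_le _ _).trans ?_; rw [norm_mul]
          _ ≤ ‖a‖ * ((d * Real.log (M m) + C) + (2 * Real.pi * |(q : ℝ)| * M m + C)) + ‖b‖ := by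
              gcongr
          _ ≤ ‖a‖ * ((d + 2 * C + 2 * Real.pi * |(q : ℝ)|) * M m) + ‖b‖ * M m := by
              have h4 : (d * Real.log (M m) + C) + (2 * Real.pi * |(q : ℝ)| * M m + C) ≤
                  (d + 2 * C + 2 * Real.pi * |(q : ℝ)|) * M m := by nlinarith [abs_nonneg (q : ℝ), Real.pi_pos]
              have h5 : ‖b‖ ≤ ‖b‖ * M m := le_mul_of_one_le_right (norm_nonneg _) hM
              nlinarith [norm_nonneg a]
          _ = K * M m := by rw [hK]; ring
      calc Real.log (2 + ‖a * x m + b‖) ≤ Real.log ((2 + K) * M m) := by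
            refine Real.log_le_log (by positivity) ?_
            nlinarith
        _ = Real.log (2 + K) + Real.log (M m) := Real.log_mul (by positivity) (by positivity)
  -- conclusion: eventually `M m = m`, and `(c/2) m / (log(2+K) + log m) → ∞`
  have hApos : 0 < Real.log (2 + K) := Real.log_pos (by linarith)
  have hlow := (tendsto_div_const_add_mul_log hApos zero_le_one).const_mul_atTop (half_pos hcpos)
  refine tendsto_atTop_mono' atTop ?_ hlow
  filter_upwards [hMm, eventually_mul_log_add_le (|a.re| * d) C₁ (half_pos hcpos),
    eventually_ge_atTop 1] with m hm hlog hm1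
  obtain ⟨hnum, hden⟩ := hest m
  rw [hm] at hnum hden
  have hm1' : (1 : ℝ) ≤ m := by exact_mod_cast hm1
  have hdenpos : 0 < Real.log (2 + ‖a * x m + b‖) :=
    Real.log_pos (by linarith [norm_nonneg (a * x m + b)])
  have hnum' : c / 2 * m ≤ |(a * x m + b).re| := by linarith
  calc c / 2 * ((m : ℝ) / (Real.log (2 + K) + 1 * Real.log m))
      = (c / 2 * m) / (Real.log (2 + K) + Real.log m) := by ring
    _ ≤ |(a * x m + b).re| / (Real.log (2 + K) + Real.log m) :=
        div_le_div_of_nonneg_right hnum' (by linarith [Real.log_natCast_nonneg m])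
    _ ≤ |(a * x m + b).re| / Real.log (2 + ‖a * x m + b‖) :=
        div_le_div_of_nonneg_left (abs_nonneg _) hdenpos hden

end NonRealSlope

end Summit.Schanuel.Schanuel.Theorems

end
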